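import Literature.Topology.FourManifolds.WallTradeIndexOne
import Literature.Topology.FourManifolds.CobordismCancelTopIndex
import Literature.Geometry.Riemannian.MeanConvexSurroundingAssembly

/-!
# Lawson–Michelsohn (1984), Thm. 6.1, the topological half: a `1`-thin domain of dimension
# `n ≥ 5` is a ball with handles of index `≤ n - 2`

Topic `Geometry/Riemannian` (fact seat
`provefact-Literature.Geometry.Riemannian.LawsonMichelsohn1984_surrounding`).  Everything here
is **proved**; no named fact is introduced.

Lawson–Michelsohn, *Embedding and surrounding with positive mean curvature*, Invent. Math. 77
(1984), proof of Thm. 6.1 (p. 416): the hypersurface `f(N) = ∂D_f` is surrounded by attaching,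
with positive mean curvature (Thm. 3.1), the handles of a handle decomposition of the `1`-thin
domain `D_f` *all of whose handles have codimension `≥ 2`*, which exists by handlebody theory
[Smale, Wall] because `π₁(D_f, N) = 0` and `n ≥ 5`.  In Morse-function form on the cobordism
`(D; ∅, N)` this is: **a Morse function without critical points of index `n` and `n - 1`**
(`n = m + 1 = dim D`).  The tree proves Milnor's Thm. 8.1 Index 0 (`CobordismCancelTopIndex.lean`,
turned about: no index `n`) and now Wall's form of Index 1 under `π₁(W, V) = 0`
(`Cobordism.wall_trade_index_one`, `WallTradeIndexOne.lean`, turned about: no index `n - 1`):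

* `Cobordism.exists_isMorseFunction_criticalSetOfIndex_top_two_eq_empty` — on a connected
  cobordism `c = (W; M, N)` of dimension `n + 1 ≥ 5` every point of which is joined to `inr N`
  and with `π₁(W, inr N) = 0` (compression form) there is a Morse function with no critical
  points of index `n + 1` or `n`;
* `Literature.Geometry.Riemannian.exists_isMorseFunction_domain` — for the data of
  `LawsonMichelsohn1984_surrounding` (`D = {F ≤ 0}` compact regular, `1`-thin, `∂D = e(N)`,
  `m ≥ 4`): the cobordism `(D; ∅, N)` carries a Morse function all of whose critical points have
  index `≤ m - 1` (L–M's "`D_f` = small balls ∪ handles of index `≤ n - 2`").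

## References

* H. B. Lawson, Jr., M.-L. Michelsohn, *Embedding and surrounding with positive mean curvature*,
  Invent. Math. 77 (1984), Thm. 6.1 and its proof (p. 416). [LawsonMichelsohn1984]
* J. Milnor, *Lectures on the h-cobordism theorem*, Princeton (1965), Thm. 8.1 and proof of
  Thm. 9.1 (turning about, PDF p. 57). [MilnorHCobordism1965]
* C. T. C. Wall, *Geometrical connectivity I*, J. London Math. Soc. (2) 3 (1971), Thm. 3.
-/

open scoped Manifold ContDiff
open Set Literature.Topology.FourManifolds Literature.Geometry.Riemannian

noncomputable section

universe u

namespace Literature.Topology.FourManifolds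

variable {n : ℕ} {M N : Type u} [TopologicalSpace M] [T2Space M] [SecondCountableTopology M]
  [ChartedSpace (EuclideanSpace ℝ (Fin n)) M] [IsManifold (𝓡 n) ∞ M] [CompactSpace M]
  [TopologicalSpace N] [T2Space N] [SecondCountableTopology N]
  [ChartedSpace (EuclideanSpace ℝ (Fin n)) N] [IsManifold (𝓡 n) ∞ N] [CompactSpace N]

/-- **No critical points of the two top indices** (Milnor 1965, Thm. 8.1 Index 0 and Wall 1971,
Thm. 3, both turned about as in the proof of Thm. 9.1): on a connected cobordism
`c = (W; M, N)` of dimension `n + 1 ≥ 5` such that every point of `W` is joined to a point of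
`inr N` (`H₀(W, N) = 0`) and every path with end points on `inr N` compresses into `inr N`
(`π₁(W, N) = 0`), there is a Morse function on `c` without critical points of index `n + 1`
and `n`. [cite: MilnorHCobordism1965, Thm. 8.1 (PDF p. 54) and proof of Thm. 9.1 (PDF p. 57)] -/
theorem Cobordism.exists_isMorseFunction_criticalSetOfIndex_top_two_eq_empty (hn : 4 ≤ n)
    (c : Cobordism n M N) [ConnectedSpace c.W] (hjoin : ∀ z : c.W, ∃ y : N, Joined z (c.inr y))
    (hrel : RelPiOneTrivial c.W (range c.inr)) :
    ∃ f : c.W → ℝ, c.IsMorseFunction f ∧ criticalSetOfIndex (𝓡∂ (n + 1)) f (n + 1) = ∅ ∧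
      criticalSetOfIndex (𝓡∂ (n + 1)) f n = ∅ := by
  -- no critical points of index `n + 1`
  obtain ⟨f₁, hf₁, htop⟩ := c.exists_isMorseFunction_criticalSetOfIndex_top_eq_empty hjoin
  -- turn about: `1 - f₁` on `(W; N, M)` has no critical points of index `0`
  have hf₁' : c.symm.IsMorseFunction fun z => 1 - f₁ z := hf₁.symm
  have h0 : criticalSetOfIndex (𝓡∂ (n + 1)) (fun z : c.symm.W => 1 - f₁ z) 0 = ∅ := by
    have h := hf₁.criticalSetOfIndex_one_sub (k := 0) (Nat.zero_le _)
    rw [Nat.sub_zero] at h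
    exact h.trans htop
  haveI : ConnectedSpace c.symm.W := ‹ConnectedSpace c.W›
  have hrel' : RelPiOneTrivial c.symm.W (range c.symm.inl) := hrel
  -- trade its critical points of index `1` (Wall)
  obtain ⟨g', hg', h1, -, -, hk⟩ := Cobordism.wall_trade_index_one hn c.symm hrel' _ hf₁' h0
  have h0' : criticalSetOfIndex (𝓡∂ (n + 1)) g' 0 = ∅ := by
    rw [hk 0 (by norm_num) (by norm_num)]; exact h0
  -- turn back
  have keyTop : criticalSetOfIndex (𝓡∂ (n + 1)) (fun z : c.symm.W => 1 - g' z) (n + 1) = ∅ := by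
    rw [hg'.criticalSetOfIndex_one_sub le_rfl, Nat.sub_self]; exact h0'
  have keyN : criticalSetOfIndex (𝓡∂ (n + 1)) (fun z : c.symm.W => 1 - g' z) n = ∅ := by
    rw [hg'.criticalSetOfIndex_one_sub (Nat.le_succ n), Nat.add_sub_cancel_left]; exact h1
  exact ⟨fun z => 1 - g' z, hg'.symm, keyTop, keyN⟩

end Literature.Topology.FourManifolds

namespace Literature.Geometry.Riemannian

variable {m : ℕ} {F : EuclideanSpace ℝ (Fin (m + 1)) → ℝ}

/-- **Lawson–Michelsohn's Thm. 6.1, the topological half: the `1`-thin domain `D = {F ≤ 0}` is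
a ball with handles of index `≤ n - 2`**, in Morse-function form.  For the data of
`LawsonMichelsohn1984_surrounding` — `m ≥ 4`, `N` a compact connected `m`-manifold, `e : N → ℝ^{m+1}`
a smooth embedding onto the regular zero set `{F = 0}` of `F` with `{F ≤ 0}` compact, and
`π₁({F ≤ 0}, {F = 0}) = 0` — the cobordism `(D; ∅, N)` (`IsRegularCompactDomain.cobordismOfEmbedding`)
carries a Morse function without critical points of index `m + 1` and `m`, i.e. all of whose
critical points have index `≤ m - 1` (*"the 1-thin domain `D_f` has a handle decomposition all
of whose handles have codimension `≥ 2`"*, by handlebody theory from `π₁(D_f, N) = 0`, `n ≥ 5`).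
[cite: LawsonMichelsohn1984, proof of Thm. 6.1 (p. 416)] [cite: MilnorHCobordism1965, Thm. 8.1] -/
theorem exists_isMorseFunction_domain (hm : 4 ≤ m) (N : Type) [TopologicalSpace N] [T2Space N]
    [SecondCountableTopology N] [CompactSpace N] [ConnectedSpace N]
    [ChartedSpace (EuclideanSpace ℝ (Fin m)) N] [IsManifold (𝓡 m) ∞ N]
    (F : EuclideanSpace ℝ (Fin (m + 1)) → ℝ) (e : N → EuclideanSpace ℝ (Fin (m + 1)))
    (hF : ContDiff ℝ ∞ F) (hD : IsCompact {x | F x ≤ 0}) (hreg : ∀ x, F x = 0 → fderiv ℝ F x ≠ 0)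
    (he : Manifold.IsSmoothEmbedding (𝓡 m) 𝓘(ℝ, EuclideanSpace ℝ (Fin (m + 1))) ∞ e)
    (hrange : range e = {x | F x = 0})
    (h1 : RelPiOneTrivial {x : EuclideanSpace ℝ (Fin (m + 1)) // F x ≤ 0} {p | F p.1 = 0}) :
    ∃ h : IsRegularCompactDomain F, ∃ f : (h.cobordismOfEmbedding (by omega) he hrange).W → ℝ,
      (h.cobordismOfEmbedding (by omega) he hrange).IsMorseFunction f ∧
      criticalSetOfIndex (𝓡∂ (m + 1)) f (m + 1) = ∅ ∧ criticalSetOfIndex (𝓡∂ (m + 1)) f m = ∅ := by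
  obtain ⟨h, hthin, hpc, -, hjoin, -⟩ := domainData hm N F e hF hD hreg he hrange h1
  refine ⟨h, ?_⟩
  haveI : ConnectedSpace (h.cobordismOfEmbedding (by omega) he hrange).W := by
    haveI := hpc
    show ConnectedSpace h.Domain
    infer_instance
  have hrel : RelPiOneTrivial (h.cobordismOfEmbedding (by omega) he hrange).W
      (range (h.cobordismOfEmbedding (by omega) he hrange).inr) := by
    rw [h.range_cobordismOfEmbedding_inr (by omega) he hrange]
    exact hthin
  exact Cobordism.exists_isMorseFunction_criticalSetOfIndex_top_two_eq_empty (by omega) _ hjoin hrel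

end Literature.Geometry.Riemannian

end
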